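import Summits.CriticalPhenomena.PercolationContinuityZ3.Theorems.PercNearOneGluingNoHeavyLowerTailSunflowerMultiPetalKempeMarked
import HarnessLib
import HarnessLib.Audit

/-!
# `NoHeavyLowerTail` (crux stmt-CriticalPhenomena-4575), marked-multigraph layer: TERMINAL SYMMETRY `T(K;u,v) = T(K;v,u)`

Support file (seat `prim-l12-p2` gen 47; `--supports stmt-CriticalPhenomena-4575`; continuation of `…KempeMarked` (p594349)).  No `sorry`; nothing is asserted
about the crux.  Memo: run/shared/lean/prim/prim-l12/prim-l12-p2/PROOF-LEMMA-B-MARKED-MULTIGRAPHS-g47.md §3 (b) ('assume y ∼ u by the (u,a) ↔ (v,b) symmetry').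

* `sw01`, `cntM_sw01`, `ctypeM_sw01` — the global colour swap `0 ↔ 1` exchanges the first two type coordinates;
* `fC_swap12` — the two-terminal weight is symmetric in them;  **`TfunM_comm`** — `TfunM K u v = TfunM K v u`.
-/

namespace Summit.CriticalPhenomena.PercolationContinuityZ3.Theorems.SunflowerPartition.Kempe

open Finset

namespace MGraph

variable {V : Type*} [Fintype V] [LinearOrder V] (K : MGraph V)

/-! ## Terminal symmetry: `T(K;u,v) = T(K;v,u)` -/

section TerminalSymmetry

/-- The colour swap `0 ↔ 1`. [this work] -/
def sw01 (c : Fin 3) : Fin 3 := if c = 0 then 1 else if c = 1 then 0 else c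

/-- `sw01` is an involution. [this work] -/
theorem sw01_sw01 : ∀ c, sw01 (sw01 c) = c := by decide

/-- `sw01 c = d ↔ c = sw01 d`. [this work] -/
theorem sw01_eq_iff : ∀ c d : Fin 3, sw01 c = d ↔ c = sw01 d := by decide

/-- The two-terminal weight is symmetric in its first two coordinates. (finite check) [this work] -/
theorem fC_swap12 : ∀ t : CType, fC (t.2.1, t.1, t.2.2) = fC t := by decide

/-- Member counts under the global colour swap `0 ↔ 1`. [this work] -/
theorem cntM_sw01 (σ : V → Fin 3) (c : Fin 3) : K.cntM (fun w => sw01 (σ w)) c = K.cntM σ (sw01 c) := by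
  unfold cntM
  have h : ∀ w, (sw01 (σ w) = c) ↔ (σ w = sw01 c) := fun w => sw01_eq_iff _ _
  simp only [h]

/-- The type under the global colour swap `0 ↔ 1` has its first two coordinates exchanged. [this work] -/
theorem ctypeM_sw01 (σ : V → Fin 3) : K.ctypeM (fun w => sw01 (σ w)) = ((K.ctypeM σ).2.1, (K.ctypeM σ).1, (K.ctypeM σ).2.2) := by
  unfold ctypeM
  rw [K.cntM_sw01 σ 0, K.cntM_sw01 σ 1, K.cntM_sw01 σ 2]
  rfl

/-- **Terminal symmetry**: `T(K;u,v) = T(K;v,u)` (swap the colours `0 ↔ 1` everywhere; `fC` is symmetric in its first two coordinates). [this work] -/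
theorem TfunM_comm (u v : V) : K.TfunM u v = K.TfunM v u := by
  unfold TfunM
  refine sum_nbij' (fun σ w => sw01 (σ w)) (fun σ w => sw01 (σ w)) (fun σ hσ => ?_) (fun σ hσ => ?_)
    (fun σ _ => funext fun w => sw01_sw01 (σ w)) (fun σ _ => funext fun w => sw01_sw01 (σ w)) (fun σ _ => ?_)
  · rw [mem_filter] at hσ ⊢
    refine ⟨mem_univ _, ?_, ?_⟩
    · simp only [hσ.2.2]; decide
    · simp only [hσ.2.1]; decide
  · rw [mem_filter] at hσ ⊢
    refine ⟨mem_univ _, ?_, ?_⟩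
    · simp only [hσ.2.2]; decide
    · simp only [hσ.2.1]; decide
  · rw [K.ctypeM_sw01 σ, fC_swap12]

end TerminalSymmetry

end MGraph

end Summit.CriticalPhenomena.PercolationContinuityZ3.Theorems.SunflowerPartition.Kempe
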